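import Literature.AlgebraicGeometry.Frobenioids.ModelFrobenioidComparisonUnits
import Literature.AlgebraicGeometry.Frobenioids.ModelFrobenioidComparisonFunctor
import Literature.AlgebraicGeometry.Frobenioids.BiratUnitsTransport
import Literature.AlgebraicGeometry.Frobenioids.ModelFrobenioidComparisonAssembly
import HarnessLib

/-!
# Frobenioids I, Theorem 5.2 (iv), proof step: the unit entry `u_φ` — identities, the cocycle, and
the unit datum

Mochizuki, *The geometry of Frobenioids I: the general theory*, Kyushu J. Math. **62** (2008)
293–400, §5, proof of Theorem 5.2 (iv), kurims text p. 102 [cite: MochizukiFrdI2008, Thm. 5.2(iv)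
p.102]:
"for the final entry, it follows from the existence of the unique factorizations of morphisms of `E`
discussed above. Note that these factorizations also imply that this functor [is functorial …]".

Over `ModelFrobenioidComparisonUnits.lean` (the factorisation `pathHom φ = F(d)^birat ≫ u_φ ≫
π_φ^birat`)
this file proves `u_{id} = 1` and the **cocycle** `u_{φ ≫ φ'} = (π_φ)^*(u_{φ'}) · u_φ^{deg φ'}`,
using:
naturality of the Frobenius-section `F` along `P`-morphisms and `F(d) F(d') = F(dd')`; birational
Frobenius-normalisation at `A` (Def. 4.5 (i), the "model type" hypothesis: `u ≫ F(d')^birat =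
F(d')^birat ≫ u^{d'}`); uniqueness of `P`-lifts; transport of units along the linear `π_φ`
(`BiratUnitsTransport.lean`); and uniqueness of the unit part.  Reading the units through a
rational-function-monoid structure `R` (`B ≅ O^×(−^birat)`, natural) yields the datum
`UnitData` of `ModelFrobenioidComparisonFunctor.lean` — the fourth entry of the comparison functor.
-/

namespace Literature.AlgebraicGeometry.Frobenioids

open CategoryTheory Opposite

universe w v v' u u'

namespace PreFrobenioid

namespace FPPath

variable {D : Type u} [Category.{v} D] {Φ : Dᵒᵖ ⥤ CommMonCat.{w}}
  {C : Type u'} [Category.{v'} C] {F : C ⥤ ElemFrobenioid Φ} {hF : IsFrobenioid F}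
  {hsq : HasBiratSquares F} {P : Presection C} {Fr : ℕ+ →* CategoryTheory.End P.ι} {X X' X'' : C}

/-! ### The chosen unit and its basic properties -/

/-- The unit part `u_φ ∈ O^×(A^birat)` of `pathHom φ` (chosen; unique by `unit_pathHom_unique`).
[cite: MochizukiFrdI2008, Thm. 5.2(iv) p.102] -/
noncomputable def unitOf (hF : IsFrobenioid F) (hsq : HasBiratSquares F)
    (hPF : IsBaseFrobeniusPair F P Fr) (hiso : IsOfIsotropicType F)
    (p : FPPath F {A | P.obj A} X) (p' : FPPath F {A | P.obj A} X') (φ : X ⟶ X') :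
    BiratUnits F hF p.A :=
  (exists_unit_pathHom (hF := hF) (hsq := hsq) hPF hiso p p' φ).choose

/-- The factorisation `pathHom φ = F(d)^birat ≫ u_φ ≫ π_φ^birat`. [cite: MochizukiFrdI2008, Thm.
5.2(iv) p.102] -/
theorem unitOf_spec (hPF : IsBaseFrobeniusPair F P Fr) (hiso : IsOfIsotropicType F)
    (p : FPPath F {A | P.obj A} X) (p' : FPPath F {A | P.obj A} X') (φ : X ⟶ X') :
    pathHom hF hsq p p' φ = (toBirat F hF hsq).map (p.frob Fr (degFr F φ)) ≫
      BiratUnits.toHom hsq (unitOf hF hsq hPF hiso p p' φ) ≫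
        (toBirat F hF hsq).map (ppart hPF.isBaseSection p p' φ) :=
  (exists_unit_pathHom (hF := hF) (hsq := hsq) hPF hiso p p' φ).choose_spec

/-- `F(1)_A = id`. [cite: MochizukiFrdI2008, Def. 2.7(ii) p.51] -/
theorem frob_one (p : FPPath F {A | P.obj A} X) : p.frob Fr 1 = 𝟙 p.A := by
  unfold frob
  rw [map_one]
  rfl

/-- `F(d)_A ≫ F(d')_A = F(d·d')_A` (`F` is a homomorphism of monoids; `ℕ_{≥1}` is commutative).
[cite: MochizukiFrdI2008, Def. 2.7(ii) p.51] -/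
theorem frob_comp (p : FPPath F {A | P.obj A} X) (d d' : ℕ+) :
    p.frob Fr d ≫ p.frob Fr d' = p.frob Fr (d * d') := by
  unfold frob
  rw [mul_comm, map_mul]
  rfl

/-- Naturality of `F(d)` along the `P`-morphism `π_φ`: `π_φ ≫ F(d)_{A'} = F(d)_A ≫ π_φ`.
[cite: MochizukiFrdI2008, Def. 2.7(ii) p.51] -/
theorem ppart_frob (hP : IsBaseSection F P) (p : FPPath F {A | P.obj A} X)
    (p' : FPPath F {A | P.obj A} X') (φ : X ⟶ X') (d : ℕ+) :
    ppart hP p p' φ ≫ p'.frob Fr d = p.frob Fr d ≫ ppart hP p p' φ :=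
  (Fr d).naturality (X := p.pobj) (Y := p'.pobj) ⟨ppart hP p p' φ, ppart_mem hP p p' φ⟩

/-- `π_{id} = id`. [cite: MochizukiFrdI2008, Thm. 5.2(iv) p.102] -/
theorem ppart_id (hP : IsBaseSection F P) (p : FPPath F {A | P.obj A} X) :
    ppart hP p p (𝟙 X) = 𝟙 p.A :=
  (ppart_unique hP p p (𝟙 X) (P.hom_id p.mem) (by rw [base_id, baseOf_id])).symm

/-- `π_{φ ≫ φ'} = π_φ ≫ π_{φ'}`. [cite: MochizukiFrdI2008, Thm. 5.2(iv) p.102] -/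
theorem ppart_comp (hP : IsBaseSection F P) (p : FPPath F {A | P.obj A} X)
    (p' : FPPath F {A | P.obj A} X') (p'' : FPPath F {A | P.obj A} X'') (φ : X ⟶ X')
    (φ' : X' ⟶ X'') :
    ppart hP p p'' (φ ≫ φ') = ppart hP p p' φ ≫ ppart hP p' p'' φ' :=
  (ppart_unique hP p p'' (φ ≫ φ') (P.hom_comp _ _ (ppart_mem hP p p' φ) (ppart_mem hP p' p'' φ'))
    (by rw [base_comp, base_ppart, base_ppart, baseOf_comp])).symm

/-- `u_{id} = 1`. [cite: MochizukiFrdI2008, Thm. 5.2(iv) p.102] -/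
theorem unitOf_id (hPF : IsBaseFrobeniusPair F P Fr) (hiso : IsOfIsotropicType F)
    (p : FPPath F {A | P.obj A} X) : unitOf hF hsq hPF hiso p p (𝟙 X) = 1 := by
  apply unit_pathHom_unique hPF p p (𝟙 X) (unitOf_spec hPF hiso p p (𝟙 X))
  rw [pathHom_id, degFr_id, frob_one, ppart_id, BiratUnits.toHom_one, CategoryTheory.Functor.map_id,
    Category.id_comp, Category.id_comp]

/-! ### Powers of units in `End(A^birat)` and birational Frobenius-normalisation -/

/-- A unit of `A^birat` lies in `O^▷(A^birat)` (base-identity, linear).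
[cite: MochizukiFrdI2008, Prop. 4.4(iv) p.83] -/
theorem toHom_mem_endSubmonoid {A : C} (u : BiratUnits F hF A) :
    (BiratUnits.toHom hsq u : CategoryTheory.End ((toBirat F hF hsq).obj A)) ∈
      endSubmonoid (Birat.toElemGp hF hsq) ((toBirat F hF hsq).obj A) := by
  obtain ⟨q, rfl⟩ := BiratUnits.mk_surjective u
  haveI : IsIso (Base F q.den) := q.den_mem.2.2
  refine ⟨?_, ?_⟩
  · change inv (Base F q.den) ≫ Base F q.num = 𝟙 _
    rw [← q.baseEq, IsIso.inv_hom_id]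
  · exact q.num_mem.2.1

/-- **Birational Frobenius-normalisation in action**: `u ≫ F(d)_A^birat = F(d)_A^birat ≫ u^d` in
`C^birat`
for `u ∈ O^×(A^birat)` (Def. 4.5 (i) / Def. 1.2 (iv) at `A^birat`). [cite: MochizukiFrdI2008, Def.
4.5(i) p.86] -/
theorem unit_comp_frob (hPF : IsBaseFrobeniusPair F P Fr) (p : FPPath F {A | P.obj A} X)
    (hbfn : IsBiratFrobeniusNormalized F hF hsq p.A) (u : BiratUnits F hF p.A) (d : ℕ+) :
    BiratUnits.toHom hsq u ≫ (toBirat F hF hsq).map (p.frob Fr d) =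
      (toBirat F hF hsq).map (p.frob Fr d) ≫ BiratUnits.toHom hsq (u ^ (d : ℕ)) := by
  have hγb : IsBaseIdentity (Birat.toElemGp hF hsq) ((toBirat F hF hsq).map (p.frob Fr d)) := by
    change Birat.gpBase ((toBirat F hF hsq).map (p.frob Fr d)) = 𝟙 _
    rw [Birat.gpBase_map, base_frob hPF]
  have hdeg : degFr (Birat.toElemGp hF hsq) ((toBirat F hF hsq).map (p.frob Fr d)) = d := by
    change Birat.gpDeg ((toBirat F hF hsq).map (p.frob Fr d)) = d
    rw [Birat.gpDeg_map, degFr_frob hPF]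
  set α : CategoryTheory.End ((toBirat F hF hsq).obj p.A) := BiratUnits.toHom hsq u with hα
  have hpow : ∀ n : ℕ, (α ^ n : CategoryTheory.End ((toBirat F hF hsq).obj p.A)) =
      BiratUnits.toHom hsq (u ^ n) := by
    intro n
    induction n with
    | zero => rw [pow_zero, pow_zero, BiratUnits.toHom_one]; rfl
    | succ n ih => rw [pow_succ, pow_succ, BiratUnits.toHom_mul, ← ih, CategoryTheory.End.mul_def]
  have h := hbfn ((toBirat F hF hsq).map (p.frob Fr d)) hγb α (toHom_mem_endSubmonoid u)
  rw [hdeg] at h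
  change (toBirat F hF hsq).map (p.frob Fr d) ≫ (α ^ (d : ℕ)) = α ≫ _ at h
  rw [hpow] at h
  exact h.symm

/-! ### The cocycle -/

/-- `π_φ` is linear (a pull-back morphism). [cite: MochizukiFrdI2008, Def. 2.7(i) p.51] -/
theorem isLinear_ppart (hF : IsFrobenioid F) (hP : IsBaseSection F P) (p : FPPath F {A | P.obj A} X)
    (p' : FPPath F {A | P.obj A} X') (φ : X ⟶ X') : IsLinear F (ppart hP p p' φ) :=
  (hF.iv_b _ (isPullbackMorphism_ppart hP p p' φ)).2

/-- **The cocycle of the unit parts**: `u_{φ ≫ φ'} = (π_φ)^*(u_{φ'}) · u_φ^{deg_Fr φ'}` in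
`O^×(A^birat)`,
where `(π_φ)^*` is the transport of units along the linear `P`-morphism `π_φ`
(`BiratUnits.transportHom`).  Ingredients: `pathHom` is functorial; naturality of `F` along `π_φ`;
birational Frobenius-normalisation at `A`; `π_{φ≫φ'} = π_φ ≫ π_{φ'}`; `F(d)F(d') = F(dd')`;
uniqueness of the unit part. [cite: MochizukiFrdI2008, Thm. 5.2(iv) p.102] -/
theorem unitOf_comp (hPF : IsBaseFrobeniusPair F P Fr) (hiso : IsOfIsotropicType F)
    (p : FPPath F {A | P.obj A} X) (p' : FPPath F {A | P.obj A} X')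
    (p'' : FPPath F {A | P.obj A} X'') (hbfn : IsBiratFrobeniusNormalized F hF hsq p.A)
    (φ : X ⟶ X') (φ' : X' ⟶ X'') :
    unitOf hF hsq hPF hiso p p'' (φ ≫ φ') =
      BiratUnits.transportHom hF hsq hiso (ppart hPF.isBaseSection p p' φ)
          (isLinear_ppart hF hPF.isBaseSection p p' φ) (unitOf hF hsq hPF hiso p' p'' φ') *
        unitOf hF hsq hPF hiso p p' φ ^ (degFr F φ' : ℕ) := by
  set u := unitOf hF hsq hPF hiso p p' φ with hu
  set u' := unitOf hF hsq hPF hiso p' p'' φ' with hu'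
  set w := BiratUnits.transportHom hF hsq hiso (ppart hPF.isBaseSection p p' φ)
    (isLinear_ppart hF hPF.isBaseSection p p' φ) u' with hw
  apply unit_pathHom_unique hPF p p'' (φ ≫ φ') (unitOf_spec hPF hiso p p'' (φ ≫ φ'))
  have e1 := unitOf_spec (hF := hF) (hsq := hsq) hPF hiso p p' φ
  have e2 := unitOf_spec (hF := hF) (hsq := hsq) hPF hiso p' p'' φ'
  rw [← hu] at e1
  rw [← hu'] at e2
  -- (i) naturality of `F(d')` along `π_φ`
  have hi : (toBirat F hF hsq).map (ppart hPF.isBaseSection p p' φ) ≫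
      (toBirat F hF hsq).map (p'.frob Fr (degFr F φ')) =
      (toBirat F hF hsq).map (p.frob Fr (degFr F φ')) ≫
        (toBirat F hF hsq).map (ppart hPF.isBaseSection p p' φ) := by
    rw [← Functor.map_comp, ppart_frob, Functor.map_comp]
  -- (ii) birational Frobenius-normalisation
  have hii := unit_comp_frob (hsq := hsq) hPF p hbfn u (degFr F φ')
  -- (iii) transport of `u'` along `π_φ`
  have hiii : BiratUnits.toHom hsq w ≫ (toBirat F hF hsq).map (ppart hPF.isBaseSection p p' φ) =
      (toBirat F hF hsq).map (ppart hPF.isBaseSection p p' φ) ≫ BiratUnits.toHom hsq u' :=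
    (BiratUnits.intertwines_iff_toHom_comm hsq _ _ _).mp
      (BiratUnits.intertwines_transportHom hiso _ (isLinear_ppart hF hPF.isBaseSection p p' φ) u')
  rw [pathHom_comp p p' p'' φ φ', e1, e2, degFr_comp, ← frob_comp, Functor.map_comp,
    ppart_comp hPF.isBaseSection p p' p'' φ φ', Functor.map_comp, BiratUnits.toHom_mul]
  simp only [Category.assoc]
  rw [reassoc_of% hi, reassoc_of% hii, reassoc_of% hiii]

/-! ### The unit datum -/

/-- **The unit datum of the comparison functor** for a Frobenioid of isotropic and model type with a
rational-function-monoid structure `R` (`B ≅ O^×(−^birat)`): `u_φ := R⁻¹(unitOf φ) ∈ B(A_D)`.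
[cite: MochizukiFrdI2008, Thm. 5.2(iv) p.102] -/
noncomputable def unitData (hF : IsFrobenioid F) (hsq : HasBiratSquares F)
    (hPF : IsBaseFrobeniusPair F P Fr) (hiso : IsOfIsotropicType F)
    (hbfn : ∀ A : C, IsBiratFrobeniusNormalized F hF hsq A) {B : Dᵒᵖ ⥤ CommMonCat.{w}}
    {DivB : B ⟶ monoidGp Φ} (R : RationalFunctionMonoidStr F hF B DivB) :
    UnitData hF hsq {A | P.obj A} B DivB where
  unit p p' φ := (R.iso p.A).symm (unitOf hF hsq hPF hiso p p' φ)
  divB_unit p p' φ := by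
    change (DivB.app (op (baseObj F p.A))).hom ((R.iso p.A).symm _) = _
    rw [← R.div_iso p.A, MulEquiv.apply_symm_apply]
    exact divHom_unit_pathHom hPF p p' φ (unitOf_spec hPF hiso p p' φ)
  unit_id p := by
    rw [unitOf_id]
    exact map_one (R.iso p.A).symm
  unit_comp p p' p'' φ φ' := by
    rw [unitOf_comp hPF hiso p p' p'' (hbfn p.A) φ φ', map_mul, map_pow]
    congr 1
    apply (R.iso p.A).injective
    rw [MulEquiv.apply_symm_apply]
    symm
    apply (BiratUnits.intertwines_iff_eq_transportHom hiso _
      (isLinear_ppart hF hPF.isBaseSection p p' φ) _ _).mp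
    have h := R.natural (ppart hPF.isBaseSection p p' φ)
      (isLinear_ppart hF hPF.isBaseSection p p' φ)
      ((R.iso p'.A).symm (unitOf hF hsq hPF hiso p' p'' φ'))
    rw [MulEquiv.apply_symm_apply, base_ppart] at h
    exact h

/-- **Theorem 5.2 (iv), reduction to the equivalence property**: for a Frobenioid of isotropic and
model type, `Thm52iv` follows once the comparison functor built from the unit datum is shown to be
an
equivalence for every base-Frobenius pair and rational-function-monoid structure.
[cite: MochizukiFrdI2008, Thm. 5.2(iv) p.102] -/
theorem thm52iv_of_isEquivalence (hF : IsFrobenioid F) (hsq : HasBiratSquares F)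
    (h : ∀ (hmod : IsOfModelType F hF hsq) (hiso : IsOfIsotropicType F) (P : Presection C)
      (Fr : ℕ+ →* CategoryTheory.End P.ι) (hPF : IsBaseFrobeniusPair F P Fr)
      (B : Dᵒᵖ ⥤ CommMonCat.{w}) (DivB : B ⟶ monoidGp Φ)
      (R : RationalFunctionMonoidStr F hF B DivB),
        (UnitData.comparison (unitData hF hsq hPF hiso hmod.2 R)).IsEquivalence) :
    Thm52iv F hF hsq :=
  thm52iv_of_comparison' hF hsq fun hmod hiso P Fr hPF B DivB R =>
    ⟨unitData hF hsq hPF hiso hmod.2 R, h hmod hiso P Fr hPF B DivB R⟩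

end FPPath

end PreFrobenioid

end Literature.AlgebraicGeometry.Frobenioids
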